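import Summits.CriticalPhenomena.SAWScalingLimit.Theses.SAWMassiveIsingTilt
import Summits.CriticalPhenomena.SAWScalingLimit.Theses.SAWTrackTransport
import Summits.CriticalPhenomena.SAWScalingLimit.Theses.SAWDefectDecoherence
import Summits.CriticalPhenomena.SAWScalingLimit.Theorems.SAWDevelopingMapHexTransferQuarterTurnCovariance
import Summits.CriticalPhenomena.SAWScalingLimit.Theorems.SAWDevelopingMapHexTransferCompassEndpoints
import Summits.CriticalPhenomena.SAWScalingLimit.Theorems.SAWDevelopingMapHexTransferAngleTransportOfTrackTransport
import Literature.Probability.RandomPlanarGeometry.SLEConvergenceCriterion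
import Literature.Probability.RandomPlanarGeometry.LoopSpaceMaps
import HarnessLib

/-!
# Crux `LatticeUniversality` (stmt-CriticalPhenomena-0807), line `registered`: the rotated Yang–Baxter relay
# composed (glue of skeleton v2, `Cruxes/LatticeUniversality/Lines/birth.lean`)

Line lead prover-line-stmt-CriticalPhenomena-0807-c1-0 (2026-08-17). The crux (route `SAWMassiveIsingTilt`,
rank 4; identical body in five sibling routes) is the asymptotic equality, on ALL bounded continuous test
functions and with no limit assumed, of the critical chordal SAW laws of `δℤ²` (`SAW.law`) and of the
honeycomb `δ·hexCenter` (`SAW.hexSAWLaw`) in every Dobrushin domain, for every pair of endpoint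
approximations.

This file proves, sorry-free, that the crux follows from five statements written out VERBATIM as
hypotheses (the registered stubs of skeleton v2; no workfile-local definition enters a statement):

1. tightness along the mesh of the critical hexagonal chordal SAW curves (= crux `HexTight`,
   stmt-CriticalPhenomena-5423, verbatim);
2. the ROTATED convention bridge in bounded-Lipschitz `∃`-form: for every hexagonal endpoint approximation
   of `D` SOME `π/3` mid-edge approximation of `σD` (`σ z = i z`) along which the critical Glazman–Manolescu
   law of `H(π/3)` in `σD` and the `σ`-image of the hexagonal law of `D` merge on bounded `1`-Lipschitz test
   functions — both walks then live on honeycombs of the SAME orientation, since the GM `π/3` honeycomb at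
   mesh `δ` is `i·(δ·hexCenter) − iδ/2` (`Cruxes.HexTransfer.YbRelay.gmSimilarity`); comparing in the
   unrotated domain (skeleton v1) would smuggle in a 90° ≡ 30° rotation covariance of the hexagonal law;
3. law-level Yang–Baxter transport `π/3 → π/2` inside the family, bounded-Lipschitz `∃`-form (weaker than
   route SAWTrackTransport's `YBLimitExists ∧ AngleUniversality`, stmt-16995 ∧ 16963:
   `thirdToSquareBL_of_trackTransport` below, through the landed `angleTransport_of_trackTransport`);
4. the off-family toll `SAWTrackTransport.YBtoUniform` (stmt-CriticalPhenomena-16966) verbatim;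
5. the abstract merging upgrade on `CurveClass ℂ`: tightness of one side + merging on bounded `1`-Lipschitz
   test functions ⇒ merging on all bounded continuous ones (provable; a separate support file lands it).

Proof (`latticeUniversality_of_rotatedRelay`): rotate the square end EXACTLY by the landed quarter-turn
covariance of the critical `δℤ²` law (`Cruxes.HexTransfer.PinTheShear.stub_quarterTurnCovariance`, item
stmt-5794): `∫ g∘curve dP^{ℤ²}(σD; σa, σb) = ∫ (g∘σ)∘curve dP^{ℤ²}(D; a, b)` (`integral_quarterTurn`); take
`g = f ∘ σ⁻¹`; the toll kills `P^{ℤ²}(σD) − Q^{π/2}(σD)` on `g`; hypotheses 3 + 2 give bounded-Lipschitz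
merging of `Q^{π/2}(σD)` with `σ_* P^{Hex}(D)` by transitivity, upgraded to `g` by hypothesis 5 and the
tightness of `σ_* P^{Hex}(D)` (hypothesis 1 pushed along `σ`). Sources: A. Glazman, I. Manolescu,
arXiv:1708.00395 §1 (the `π/3` point), §4; V. Beffara, *Is critical 2D percolation universal?* (2008) §2.2
(order-4 symmetry of `ℤ²`); A. D'Aristotile, P. Diaconis, D. Freedman, *On merging of probabilities* (1988).
-/

noncomputable section

namespace Summit.CriticalPhenomena.SAWScalingLimit.Cruxes.LatticeUniversality.Birth

open MeasureTheory Filter Topology Set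
open scoped NNReal ENNReal BoundedContinuousFunction
open Complex (I I_ne_zero)
open Literature.Probability.RandomPlanarGeometry
open Literature.Probability.RandomPlanarGeometry.SAW
open Literature.Probability.RandomPlanarGeometry.SAW.YangBaxter
open Literature.Probability.LatticeModels (Site HexVertex hexGraph hexCenter)
open Summit.CriticalPhenomena.SAWScalingLimit.Theses

/-! ### The quarter turn at the square end (exact) -/

/-- `σ⁻¹ ∘ σ = id` on curve classes, `σ z = i z`, `σ⁻¹ z = −i z` (both as the tree's similarities).
[folklore] -/
theorem map_negI_map_I (c : CurveClass ℂ) :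
    CurveClass.map (similarity (-I) (neg_ne_zero.2 I_ne_zero) 0 : C(ℂ, ℂ))
      (CurveClass.map (similarity I I_ne_zero 0 : C(ℂ, ℂ)) c) = c := by
  rw [CurveClass.map_map]
  have h : (similarity (-I) (neg_ne_zero.2 I_ne_zero) 0 : C(ℂ, ℂ)).comp
      (similarity I I_ne_zero 0 : C(ℂ, ℂ)) = ContinuousMap.id ℂ := by
    ext1 z
    simp only [ContinuousMap.comp_apply, ContinuousMap.id_apply, ContinuousMap.coe_coe,
      similarity_apply, add_zero]
    rw [← mul_assoc, neg_mul, Complex.I_mul_I, neg_neg, one_mul]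
  rw [h, CurveClass.map_id]

/-- **The quarter turn at the level of test-function integrals** (from the landed exact covariance of the
critical `δℤ²` SAW law, item stmt-5794): for every bounded continuous `g`,
`∫ g∘curve dP^{ℤ²}(σΩ; σa, σb) = ∫ (g∘σ)∘curve dP^{ℤ²}(Ω; a, b)`, `σ z = i z`, `σ(x, y) = (−y, x)` on sites.
[folklore] -/
theorem integral_quarterTurn (Ω : Set ℂ) (δ : ℝ) (a b : Site 2)
    (g : BoundedContinuousFunction (CurveClass ℂ) ℝ) :
    ∫ γ, g γ.curve ∂(SAW.law ((similarity I I_ne_zero 0) '' Ω) δ ![-(a 1), a 0] ![-(b 1), b 0]) =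
      ∫ γ, g (CurveClass.map (similarity I I_ne_zero 0 : C(ℂ, ℂ)) γ.curve) ∂(SAW.law Ω δ a b) := by
  have h := Cruxes.HexTransfer.PinTheShear.stub_quarterTurnCovariance.1 Ω δ a b
  have hσ : Measurable (CurveClass.map (similarity I I_ne_zero 0 : C(ℂ, ℂ))) :=
    measurable_curveClassMap_similarity I I_ne_zero 0
  have hc : AEMeasurable (fun γ : SAW.DomainSAW ((similarity I I_ne_zero 0) '' Ω) δ ![-(a 1), a 0]
      ![-(b 1), b 0] => γ.curve) (SAW.law ((similarity I I_ne_zero 0) '' Ω) δ ![-(a 1), a 0] ![-(b 1), b 0]) :=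
    (SAW.DomainSAW.measurable_of_top _).aemeasurable
  have hc' : AEMeasurable (fun γ : SAW.DomainSAW Ω δ a b => γ.curve) (SAW.law Ω δ a b) :=
    (SAW.DomainSAW.measurable_of_top _).aemeasurable
  calc ∫ γ, g γ.curve ∂(SAW.law ((similarity I I_ne_zero 0) '' Ω) δ ![-(a 1), a 0] ![-(b 1), b 0])
      = ∫ c, g c ∂((SAW.law ((similarity I I_ne_zero 0) '' Ω) δ ![-(a 1), a 0] ![-(b 1), b 0]).map
          fun γ => γ.curve) := (integral_map hc g.continuous.aestronglyMeasurable).symm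
    _ = ∫ c, g c ∂(((SAW.law Ω δ a b).map fun γ => γ.curve).map
          (CurveClass.map (similarity I I_ne_zero 0 : C(ℂ, ℂ)))) := by rw [← h]
    _ = ∫ c, g (CurveClass.map (similarity I I_ne_zero 0 : C(ℂ, ℂ)) c)
          ∂((SAW.law Ω δ a b).map fun γ => γ.curve) :=
        integral_map hσ.aemeasurable g.continuous.aestronglyMeasurable
    _ = ∫ γ, g (CurveClass.map (similarity I I_ne_zero 0 : C(ℂ, ℂ)) γ.curve) ∂(SAW.law Ω δ a b) :=
        integral_map hc' (g.continuous.comp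
          (CurveClass.lipschitzWith_map (lipschitzWith_similarity I I_ne_zero 0)).continuous).aestronglyMeasurable

/-! ### Tightness pushes forward; normalised laws have mass `≤ 1` -/

/-- Tightness along the mesh is preserved by a continuous map of the state space (images of compacts are
compact). [folklore] -/
theorem isTightAlongMesh_comp {Ωδ : ℝ → Type*} [∀ δ, MeasurableSpace (Ωδ δ)] {X X' : Type*}
    [TopologicalSpace X] [TopologicalSpace X'] {Y : ∀ δ, Ωδ δ → X} {P : ∀ δ, Measure (Ωδ δ)}
    (h : IsTightAlongMesh Y P) {φ : X → X'} (hφ : Continuous φ) :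
    IsTightAlongMesh (fun δ ω => φ (Y δ ω)) P := by
  intro ε hε
  obtain ⟨K, hK, hev⟩ := h ε hε
  refine ⟨φ '' K, hK.image hφ, hev.mono fun δ hδ => le_trans (measure_mono ?_) hδ⟩
  intro ω hω hK'
  exact hω (Set.mem_image_of_mem φ hK')

/-- A normalised law `Z⁻¹ • W` has total mass `≤ 1` (mass `1`, or the junk value `0` when `Z ∈ {0, ∞}`).
[folklore] -/
theorem smul_inv_univ_le_one {α : Type*} [MeasurableSpace α] (W : Measure α) :
    ((W Set.univ)⁻¹ • W) Set.univ ≤ 1 := by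
  rw [Measure.smul_apply, smul_eq_mul]
  exact ENNReal.inv_mul_le_one _

/-- The Yang–Baxter law has total mass `≤ 1`. [folklore] -/
theorem ybLaw_univ_le_one (Θ : ℤ → ℝ) (Ω : Set ℂ) (δ x : ℝ) (a b : MidEdge) :
    ybLaw Θ Ω δ x a b Set.univ ≤ 1 :=
  smul_inv_univ_le_one _

/-- The hexagonal law has total mass `≤ 1`. [folklore] -/
theorem hexSAWLaw_univ_le_one (Ω : Set ℂ) (δ : ℝ) (a b : HexVertex) :
    SAW.hexSAWLaw Ω δ a b Set.univ ≤ 1 :=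
  smul_inv_univ_le_one _

/-! ### The composition -/

/-- **The rotated Yang–Baxter relay, composed** (crux stmt-CriticalPhenomena-0807 from the five registered
stub statements of skeleton v2, written out): tightness of the hexagonal end (= `HexTight`, stmt-5423) →
rotated convention bridge (bounded-Lipschitz `∃`-form) → transport `π/3 → π/2` (bounded-Lipschitz `∃`-form) →
the toll `YBtoUniform` (stmt-16966) → the merging upgrade → `LatticeUniversality`. Fix `D`, `(a, b)`,
`(a', b')`, `f`; put `σ z = i z`, `g = f ∘ σ⁻¹`; rotate the square end exactly (`integral_quarterTurn`), run
the toll in `σD` on `g`, merge `Q^{π/2}(σD)` with `σ_* P^{Hex}(D)` on Lipschitz functions by transitivity and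
upgrade with the tightness of `σ_* P^{Hex}(D)`; unrotate the test function at the hexagonal end
(`g ∘ σ = f`). [folklore] -/
theorem latticeUniversality_of_rotatedRelay : (∀ (D : DobrushinDomain) (a b : ℝ → HexVertex), SAW.IsEmbEndpointApprox hexGraph hexCenter D a b → IsTightAlongMesh (fun δ (γ : SAW.HexDomainSAW D.carrier δ (a δ) (b δ)) => γ.curve) (fun δ => SAW.hexSAWLaw D.carrier δ (a δ) (b δ))) → (∀ (D : DobrushinDomain) (a b : ℝ → HexVertex), SAW.IsEmbEndpointApprox hexGraph hexCenter D a b → ∃ a' b' : ℝ → MidEdge, IsYBEndpointApprox (fun (_ : ℤ) => Real.pi / 3) (D.map (similarity I I_ne_zero 0)) a' b' ∧ ∀ f : BoundedContinuousFunction (CurveClass ℂ) ℝ, LipschitzWith 1 f → Tendsto (fun δ : ℝ => (∫ γ, f (γ.curve (fun (_ : ℤ) => Real.pi / 3) δ) ∂(ybLaw (fun (_ : ℤ) => Real.pi / 3) (D.map (similarity I I_ne_zero 0)).carrier δ 1 (a' δ) (b' δ))) - ∫ γ, f (CurveClass.map (similarity I I_ne_zero 0 : C(ℂ, ℂ)) γ.curve)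 ∂(SAW.hexSAWLaw D.carrier δ (a δ) (b δ))) (𝓝[>] (0 : ℝ)) (𝓝 0)) → (∀ (D : DobrushinDomain) (a b : ℝ → MidEdge), IsYBEndpointApprox (fun (_ : ℤ) => Real.pi / 3) D a b → ∃ a' b' : ℝ → MidEdge, IsYBEndpointApprox (fun (_ : ℤ) => Real.pi / 2) D a' b' ∧ ∀ f : BoundedContinuousFunction (CurveClass ℂ) ℝ, LipschitzWith 1 f → Tendsto (fun δ : ℝ => (∫ γ, f (γ.curve (fun (_ : ℤ) => Real.pi / 3) δ) ∂(ybLaw (fun (_ : ℤ) => Real.pi / 3) D.carrier δ 1 (a δ) (b δ))) - ∫ γ, f (γ.curve (fun (_ : ℤ) => Real.pi / 2) δ) ∂(ybLaw (fun (_ : ℤ) => Real.pi / 2) D.carrier δ 1 (a' δ) (b' δ))) (𝓝[>] (0 : ℝ)) (𝓝 0)) → SAWTrackTransport.YBtoUniform → (∀ (Ω₁ Ω₂ : ℝ → Type) [∀ δ, MeasurableSpace (Ω₁ δ)] [∀ δ, MeasurableSpace (Ω₂ δ)] (X : ∀ δ, Ω₁ δ → CurveClass ℂ) (Y : ∀ δ,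 Ω₂ δ → CurveClass ℂ) (P : ∀ δ, Measure (Ω₁ δ)) (Q : ∀ δ, Measure (Ω₂ δ)), (∀ δ, Measurable (X δ)) → (∀ δ, Measurable (Y δ)) → (∀ δ, P δ Set.univ ≤ 1) → (∀ δ, Q δ Set.univ ≤ 1) → IsTightAlongMesh Y Q → (∀ f : BoundedContinuousFunction (CurveClass ℂ) ℝ, LipschitzWith 1 f → Tendsto (fun δ : ℝ => (∫ ω, f (X δ ω) ∂(P δ)) - ∫ ω, f (Y δ ω) ∂(Q δ)) (𝓝[>] (0 : ℝ)) (𝓝 0)) → ∀ f : BoundedContinuousFunction (CurveClass ℂ) ℝ, Tendsto (fun δ : ℝ => (∫ ω, f (X δ ω) ∂(P δ)) - ∫ ω, f (Y δ ω) ∂(Q δ)) (𝓝[>] (0 : ℝ)) (𝓝 0)) → SAWMassiveIsingTilt.LatticeUniversality := by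
  intro hT h1 h2 h3 hU D a b a' b' hab hab' f
  -- the rotated `δℤ²` approximation of `σD` and the relay's approximations on `σD`
  have habσ := Cruxes.HexTransfer.PinTheShear.stub_quarterTurnCovariance.2 D a b hab
  obtain ⟨a₃, b₃, hab₃, hH⟩ := h1 D a' b' hab'
  obtain ⟨a₂, b₂, hab₂, hA⟩ := h2 (D.map (similarity I I_ne_zero 0)) a₃ b₃ hab₃
  -- the transported test function `g = f ∘ σ⁻¹`, with `g (σ c) = f c`
  set g : BoundedContinuousFunction (CurveClass ℂ) ℝ := f.compContinuous
    ⟨CurveClass.map (similarity (-I) (neg_ne_zero.2 I_ne_zero) 0 : C(ℂ, ℂ)),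
      (CurveClass.lipschitzWith_map
        (lipschitzWith_similarity (-I) (neg_ne_zero.2 I_ne_zero) 0)).continuous⟩ with hg_def
  have hg : ∀ c, g (CurveClass.map (similarity I I_ne_zero 0 : C(ℂ, ℂ)) c) = f c := fun c => by
    simp only [hg_def, BoundedContinuousFunction.compContinuous_apply, ContinuousMap.coe_mk, map_negI_map_I]
  -- bracket 1: the toll in `σD` on `g` (merging on all bounded continuous test functions)
  have hZ := h3 (D.map (similarity I I_ne_zero 0)) (fun δ => ![-(a δ 1), a δ 0])
    (fun δ => ![-(b δ 1), b δ 0]) a₂ b₂ habσ hab₂ g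
  -- brackets 2 + 3: bounded-Lipschitz merging `Q^{π/2}(σD) ↔ σ_* P^{Hex}(D)` by transitivity …
  have hBL : ∀ φ : BoundedContinuousFunction (CurveClass ℂ) ℝ, LipschitzWith 1 φ →
      Tendsto (fun δ : ℝ =>
          (∫ γ, φ (γ.curve (fun (_ : ℤ) => Real.pi / 2) δ)
              ∂(ybLaw (fun (_ : ℤ) => Real.pi / 2) (D.map (similarity I I_ne_zero 0)).carrier δ 1
                  (a₂ δ) (b₂ δ))) -
            ∫ γ, φ (CurveClass.map (similarity I I_ne_zero 0 : C(ℂ, ℂ)) γ.curve)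
              ∂(SAW.hexSAWLaw D.carrier δ (a' δ) (b' δ)))
        (𝓝[>] (0 : ℝ)) (𝓝 0) := by
    intro φ hφ
    have h := (hH φ hφ).sub (hA φ hφ)
    rw [sub_zero] at h
    exact h.congr fun δ => by ring
  -- … upgraded to all bounded continuous test functions by the tightness of the hexagonal end
  have hTY : IsTightAlongMesh
      (fun δ (γ : SAW.HexDomainSAW D.carrier δ (a' δ) (b' δ)) =>
        CurveClass.map (similarity I I_ne_zero 0 : C(ℂ, ℂ)) γ.curve)
      (fun δ => SAW.hexSAWLaw D.carrier δ (a' δ) (b' δ)) :=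
    isTightAlongMesh_comp (hT D a' b' hab')
      (CurveClass.lipschitzWith_map (lipschitzWith_similarity I I_ne_zero 0)).continuous
  have hXY := hU (fun δ => YangBaxterSAW (fun (_ : ℤ) => Real.pi / 2)
      (D.map (similarity I I_ne_zero 0)).carrier δ (a₂ δ) (b₂ δ))
    (fun δ => SAW.HexDomainSAW D.carrier δ (a' δ) (b' δ))
    (fun δ γ => γ.curve (fun (_ : ℤ) => Real.pi / 2) δ)
    (fun δ γ => CurveClass.map (similarity I I_ne_zero 0 : C(ℂ, ℂ)) γ.curve)
    (fun δ => ybLaw (fun (_ : ℤ) => Real.pi / 2) (D.map (similarity I I_ne_zero 0)).carrier δ 1 (a₂ δ) (b₂ δ))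
    (fun δ => SAW.hexSAWLaw D.carrier δ (a' δ) (b' δ))
    (fun δ => YBWalk.measurable_of_top _) (fun δ => SAW.EmbDomainSAW.measurable_of_top _)
    (fun δ => ybLaw_univ_le_one _ _ _ _ _ _) (fun δ => hexSAWLaw_univ_le_one _ _ _ _) hTY hBL g
  -- assemble
  have h := hZ.add hXY
  rw [add_zero] at h
  refine h.congr fun δ => ?_
  have hq : ∫ γ, g γ.curve ∂(SAW.law (D.map (similarity I I_ne_zero 0)).carrier δ ![-(a δ 1), a δ 0]
      ![-(b δ 1), b δ 0]) = ∫ γ, g (CurveClass.map (similarity I I_ne_zero 0 : C(ℂ, ℂ)) γ.curve)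
        ∂(SAW.law D.carrier δ (a δ) (b δ)) :=
    integral_quarterTurn D.carrier δ (a δ) (b δ) g
  simp only [hg] at hq ⊢
  linarith [hq]

/-! ### Where stub 3 sits -/

/-- **Stub 3 follows from route SAWTrackTransport's `YBLimitExists` (stmt-16995) and `AngleUniversality`
(stmt-16963)**: through the landed reduction `angleTransport_of_trackTransport` (strong merging, `∀∀`-form),
picking the landed compass endpoint approximation at `π/2` and forgetting that the test function is Lipschitz.
[folklore] -/
theorem thirdToSquareBL_of_trackTransport (hL : SAWTrackTransport.YBLimitExists)
    (hAU : SAWTrackTransport.AngleUniversality) :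
    ∀ (D : DobrushinDomain) (a b : ℝ → MidEdge), IsYBEndpointApprox (fun (_ : ℤ) => Real.pi / 3) D a b →
      ∃ a' b' : ℝ → MidEdge, IsYBEndpointApprox (fun (_ : ℤ) => Real.pi / 2) D a' b' ∧
        ∀ f : BoundedContinuousFunction (CurveClass ℂ) ℝ, LipschitzWith 1 f →
          Tendsto (fun δ : ℝ =>
              (∫ γ, f (γ.curve (fun (_ : ℤ) => Real.pi / 3) δ)
                  ∂(ybLaw (fun (_ : ℤ) => Real.pi / 3) D.carrier δ 1 (a δ) (b δ))) -
                ∫ γ, f (γ.curve (fun (_ : ℤ) => Real.pi / 2) δ)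
                  ∂(ybLaw (fun (_ : ℤ) => Real.pi / 2) D.carrier δ 1 (a' δ) (b' δ)))
            (𝓝[>] (0 : ℝ)) (𝓝 0) := by
  intro D a b hab
  obtain ⟨a', b', hab'⟩ := Cruxes.HexTransfer.Sketch.stub_compassEndpoints D
  exact ⟨a', b', hab', fun f _ =>
    Cruxes.HexTransfer.YbRelay.angleTransport_of_trackTransport hL hAU D a b a' b' hab hab' f⟩

end Summit.CriticalPhenomena.SAWScalingLimit.Cruxes.LatticeUniversality.Birth

end
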